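import Summits.HodgeConjecture.HodgeConjecture.Theorems.F0P3cStCharTSArtinMonoid           -- ★ p848426 «ARTIN-B» `eq_zero_of_sum_mul_char_eq_zero_on_subsemigroup`
import Summits.HodgeConjecture.HodgeConjecture.Theorems.F0P3cStCharTSJacquetLine           -- ★ p848367 «JDIM2» `finrank_coinvariants_le_two`, «KEYS-JQ» `labelledPair_xi`, `finrank_coinvariants_eq_one_of_equiv_twist`
import Literature.NumberTheory.Automorphic.U3JacquetVanishingSupercuspidal                  -- ★ `u3_isSupercuspidal_iff_jacquet_eq_zero_mpr` (Harish-Chandra's criterion, ⇐)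
import Literature.NumberTheory.Rogawski1990.CMLocalAPacketMembers                           -- ★ `KeysCaseTwoLabels`, `Gqs`
import HarnessLib

/-!
# F0 · P3c · line LH6 «StCharTS» — organ (S-ii) CORE: Artin with multiplicities (cardinality form) and «the member `≠ π²` is supercuspidal once
# `dim V_N(πp) = dim V_N(πm) + 1`» ([Rogawski1990, Lemma 12.7.3, end of the proof p. 195], on `U(Φ₃)(L⁺_v)`)

Cell `pub/hodgecm-mathlib`, crux H413 = `stmt-HodgeConjecture-24833` (lane `--supports … --as helper`), route HCCMUnconditional; seat LH6-p03 (g0); desk F0P3b-plan (g23)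
RULING 04:10:49Z «(S-ii) = LH6-p03».  THEOREMS ONLY, sorry-free, ★-only imports; no definition ∕ instance ∕ notation ∕ named fact.  File 1 of 2 of the (S-ii) closing
(file 2: `Theorems/F0P3cStCharTSCuspidalOfXIG.lean`, the organ over «XIG-St»).
HONEST LABEL: HC_CM is proved only modulo the 7 printed citations (2 remaining: hLiu418 = stmt-HodgeConjecture-24832, h413 = stmt-HodgeConjecture-24833) until rung 0
closes; nothing here pays a letter — count-neutral in-house structure.

CONTENTS.
* §1 `card_eq_card_add_one_of_forall_sum_sub_sum_eq` — if on a generating subsemigroup `B` of a group `T` the character sums of two finite multisets `s₁, s₂` of characters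
  differ by a character `θ`, then `s₁ = s₂ + {θ}` as multisets and `card s₁ = card s₂ + 1` (Artin's independence ★ «ARTIN-B» with multiplicities; the ★ kit
  `F0P3cStCharTSShellKit.mem_of_forall_sum_sub_sum_eq` reads off only `θ ∈ s₁` — same skeleton, stronger ending).
* §2 `member_eq_of_support_pair` (two-point support bookkeeping) and `isSupercuspidal_of_finrank_succ` — at a non-split `v`, with Keys' labels `(π², πⁿ)` at the head's tokens,
  the (β)-datum `aX` (support `{πp, πm}`, values `(1, −1)`, `aX π² = 1`) and the JACQUET-DIMENSION STEP «`finrank V_N(rp) = finrank V_N(rm) + 1` for all representatives»: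
  every member `π ≠ π²` is supercuspidal — `π² = πp`; ★ «KEYS-JQ» gives `π²` a representative with `r_B ≃ ℂ_χ` (dim `1`); so `V_N(πm) = 0` (finite-dimensional by ★ «JDIM2»);
  Harish-Chandra's criterion ★ `u3_isSupercuspidal_iff_jacquet_eq_zero_mpr`.  Print: «The character of `π_2` must then be compactly supported on `M` and `π_2` is thus
  supercuspidal» [Rogawski1990 p. 195].

## References
* [Rogawski1990] J. D. Rogawski, *Automorphic Representations of Unitary Groups in Three Variables*, Ann. of Math. Stud. 123 (1990): §12.7 Lemma 12.7.3 p. 195; §12.2 p. 173.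
* [Casselman1995] W. Casselman, *Introduction to the theory of admissible representations of p-adic reductive groups* (1995): Thm. 5.3.1, L. 7.1.1 (a), Prop. 2.1.9.
* [Lang2002] S. Lang, *Algebra*, GTM 211 (2002): VI §4 Thm. 4.1 (Artin's independence of characters).
* [HarishChandra1970] Harish-Chandra, *Harmonic analysis on reductive p-adic groups*, LNM 162 (1970): Part I §3.
-/

set_option autoImplicit false
-- the mandated namespace has the single-problem summit's repeated segment (`HodgeConjecture.HodgeConjecture`)
set_option linter.dupNamespace false

noncomputable section

open Module NumberField IsDedekindDomain MeasureTheory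
open scoped Matrix

open Literature.NumberTheory Literature.NumberTheory.Automorphic Literature.NumberTheory.Automorphic.UnitaryGroup
open Literature.NumberTheory.GaloisRepresentations
open Literature.NumberTheory.Rogawski1990

namespace Summit.HodgeConjecture.HodgeConjecture.Cruxes.H413.F0P3cStCharTSCuspidalCore

/-! ## §1 Artin with multiplicities: the cardinality form -/

/-- **From the shell identity of eigencharacter multisets to the CARDINALITY STEP.**  If on a generating subsemigroup `B` of `T` the difference of the character sums of
two finite multisets `s₁, s₂` of characters equals a character `θ`, then `s₁ = s₂ + {θ}` as multisets, hence `card s₁ = card s₂ + 1` (Artin's independence of characters on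
`B`, ★ «ARTIN-B», applied to the DISTINCT characters occurring, with coefficients the multiplicities; same proof as ★ `F0P3cStCharTSShellKit.mem_of_forall_sum_sub_sum_eq`,
which reads off only `θ ∈ s₁`). [cite: Rogawski1990, §12.7 proof of Lemma 12.7.3 p. 195] [cite: Lang2002, VI §4 Thm. 4.1] -/
theorem card_eq_card_add_one_of_forall_sum_sub_sum_eq {T : Type*} [Group T] (B : Subsemigroup T) (hB : Subgroup.closure (B : Set T) = ⊤) (hne : ∃ b, b ∈ B)
    (s₁ s₂ : Multiset (T →* ℂˣ)) (θ : T →* ℂˣ)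
    (h : ∀ b ∈ B, (s₁.map fun η : T →* ℂˣ => ((η b : ℂˣ) : ℂ)).sum - (s₂.map fun η : T →* ℂˣ => ((η b : ℂˣ) : ℂ)).sum = ((θ b : ℂˣ) : ℂ)) :
    Multiset.card s₁ = Multiset.card s₂ + 1 := by
  classical
  -- the finite set of characters in play
  set S : Finset (T →* ℂˣ) := (s₁ + s₂ + {θ}).toFinset with hS
  have hθS : θ ∈ S := by rw [hS, Multiset.mem_toFinset]; simp
  have hsub₁ : s₁.toFinset ⊆ S := by
    intro η hη; rw [Multiset.mem_toFinset] at hη; rw [hS, Multiset.mem_toFinset]; simp [hη]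
  have hsub₂ : s₂.toFinset ⊆ S := by
    intro η hη; rw [Multiset.mem_toFinset] at hη; rw [hS, Multiset.mem_toFinset]; simp [hη]
  -- multiset character sums as sums over `S` weighted by multiplicities
  have hsum : ∀ s : Multiset (T →* ℂˣ), s.toFinset ⊆ S → ∀ b : T,
      (s.map fun η : T →* ℂˣ => ((η b : ℂˣ) : ℂ)).sum = ∑ η : ↥S, (s.count η.1 : ℂ) * ((η.1 b : ℂˣ) : ℂ) := by
    intro s hs b
    have h1 : ∑ η ∈ s.toFinset, s.count η • ((η b : ℂˣ) : ℂ) = ∑ η ∈ S, s.count η • ((η b : ℂˣ) : ℂ) :=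
      Finset.sum_subset hs fun η _ hη => by
        rw [Multiset.mem_toFinset, ← Multiset.count_eq_zero] at hη
        rw [hη, zero_smul]
    rw [Finset.sum_multiset_map_count, h1, ← Finset.sum_coe_sort S]
    simp only [nsmul_eq_mul]
  -- the coefficient vector `c = mult_{s₁} − mult_{s₂} − [· = θ]` vanishes on `B`
  let c : ↥S → ℂ := fun η => (s₁.count η.1 : ℂ) - (s₂.count η.1 : ℂ) - if η.1 = θ then 1 else 0
  have hc : ∀ b ∈ B, ∑ η : ↥S, c η * ((η.1 b : ℂˣ) : ℂ) = 0 := by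
    intro b hb
    have hθ : ((θ b : ℂˣ) : ℂ) = ∑ η : ↥S, (if η.1 = θ then (1 : ℂ) else 0) * ((η.1 b : ℂˣ) : ℂ) := by
      rw [Finset.sum_eq_single ⟨θ, hθS⟩]
      · simp
      · intro η _ hne
        have hne' : η.1 ≠ θ := fun h => hne (Subtype.ext h)
        rw [if_neg hne', zero_mul]
      · intro h; exact absurd (Finset.mem_univ _) h
    have hb' := h b hb
    rw [hsum s₁ hsub₁, hsum s₂ hsub₂, hθ, ← sub_eq_zero, ← Finset.sum_sub_distrib, ← Finset.sum_sub_distrib] at hb'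
    have key : ∑ η : ↥S, c η * ((η.1 b : ℂˣ) : ℂ) =
        ∑ η : ↥S, ((s₁.count η.1 : ℂ) * ((η.1 b : ℂˣ) : ℂ) - (s₂.count η.1 : ℂ) * ((η.1 b : ℂˣ) : ℂ) -
          (if η.1 = θ then (1 : ℂ) else 0) * ((η.1 b : ℂˣ) : ℂ)) :=
      Finset.sum_congr rfl fun η _ => by simp only [c]; ring
    rw [key]; exact hb'
  -- Artin: `c = 0`; read at EVERY character: the multiset identity `s₁ = s₂ + {θ}`
  have hc0 := F0P3cStCharTSArtinMonoid.eq_zero_of_sum_mul_char_eq_zero_on_subsemigroup B hB hne (fun η : ↥S => η.1)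
    Subtype.val_injective c hc
  have heq : s₁ = s₂ + {θ} := by
    refine Multiset.ext.2 fun η => ?_
    rw [Multiset.count_add, Multiset.count_singleton]
    by_cases hη : η ∈ S
    · have h1 := congr_fun hc0 ⟨η, hη⟩
      simp only [c, Pi.zero_apply] at h1
      by_cases hηθ : η = θ
      · rw [if_pos hηθ] at h1
        rw [if_pos hηθ]
        have hnat : ((s₁.count η : ℕ) : ℂ) = ((s₂.count η + 1 : ℕ) : ℂ) := by push_cast; linear_combination h1
        exact Nat.cast_injective hnat
      · rw [if_neg hηθ] at h1
        rw [if_neg hηθ, add_zero]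
        have hnat : ((s₁.count η : ℕ) : ℂ) = ((s₂.count η : ℕ) : ℂ) := by linear_combination h1
        exact Nat.cast_injective hnat
    · have h1 : η ∉ s₁ := fun hm => hη (hsub₁ (Multiset.mem_toFinset.2 hm))
      have h2 : η ∉ s₂ := fun hm => hη (hsub₂ (Multiset.mem_toFinset.2 hm))
      have h3 : η ≠ θ := fun h3 => hη (h3 ▸ hθS)
      rw [Multiset.count_eq_zero.2 h1, Multiset.count_eq_zero.2 h2, if_neg h3]
  rw [heq, Multiset.card_add, Multiset.card_singleton]

/-! ## §2 The support bookkeeping and the core of (S-ii): `dim V_N(πp) = dim V_N(πm) + 1` ⇒ the member `≠ π²` is supercuspidal -/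

section Core

variable (L : Type) [Field L] [NumberField L] [IsCMField L] (v : HeightOneSpectrum (𝓞 ↥(maximalRealSubfield L)))

/-- **Bookkeeping of the two-point support**: with `supp aX = {πp, πm}`, `aX πp = 1`, `aX πm = −1` and `aX π2 = 1`, the label `π2` IS `πp`, and every member
`π ≠ π2` is `πm`. [cite: Rogawski1990, §12.7 Lemma 12.7.3 p. 195] -/
theorem member_eq_of_support_pair {ι : Type*} (aX : ι → ℤ) {πp πm π2 : ι} (hsupp : Function.support aX = {πp, πm})
    (hm : aX πm = -1) (h2 : aX π2 = 1) :
    π2 = πp ∧ ∀ π : ι, aX π ≠ 0 → π ≠ π2 → π = πm := by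
  have h2supp : π2 ∈ Function.support aX := by rw [Function.mem_support, h2]; exact one_ne_zero
  rw [hsupp, Set.mem_insert_iff, Set.mem_singleton_iff] at h2supp
  have h2p : π2 = πp := by
    rcases h2supp with h | h
    · exact h
    · exfalso; rw [h, hm] at h2; norm_num at h2
  refine ⟨h2p, fun π hπ hπ2 => ?_⟩
  have hπsupp : π ∈ Function.support aX := Function.mem_support.2 hπ
  rw [hsupp, Set.mem_insert_iff, Set.mem_singleton_iff] at hπsupp
  rcases hπsupp with h | h
  · exact absurd (h.trans h2p.symm) hπ2
  · exact h

set_option synthInstance.maxHeartbeats 400000 in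
set_option maxHeartbeats 4000000 in
/-- **CORE of (S-ii): the `−1` member is supercuspidal once `dim r_B(rep πp) = dim r_B(rep πm) + 1`.**  At a non-split `v`, with Keys' labels `(π², πⁿ)` at the head's
tokens, a two-point datum `aX` (support `{πp, πm}`, values `(1, −1)`) with `aX π² = 1`, and the JACQUET-DIMENSION STEP «`finrank r_B(rp) = finrank r_B(rm) + 1` for all
representatives `rp` of `πp`, `rm` of `πm`» (the output of the (β)-identity on the shells, LH6-p02's `finrank_jacquet_eq_succ_of_XIG`): every member `π ≠ π²` is supercuspidal.
Proof: `π² = πp`, `π = πm`; ★ «KEYS-JQ» gives `π²` a representative with ONE-dimensional Jacquet module (`r_B ≃ ℂ_χ`, ★ `finrank_coinvariants_eq_one_of_equiv_twist`), so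
`finrank r_B(rm) = 0`, `r_B(rm) = 0` (finite-dimensional by ★ «JDIM2»), and Harish-Chandra's criterion ★ `u3_isSupercuspidal_iff_jacquet_eq_zero_mpr` concludes.
[cite: Rogawski1990, §12.7 Lemma 12.7.3 p. 195; §12.2 p. 173] [cite: Casselman1995, Thm. 5.3.1, L. 7.1.1 (a)] -/
theorem isSupercuspidal_of_finrank_succ (hns : ∀ w : PlacesOver L v, IsCMField.complexConj L • w.1 = w.1) (μ : HeckeCharacter L)
    (hμω : ∀ x : Literature.NumberTheory.GaloisRepresentations.ideleGroup ↥(maximalRealSubfield L),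
      μ (AdeleRing.ideleBaseChange (↥(maximalRealSubfield L)) L x) = quadraticHeckeCharCM L x)
    (ξ : OneDimAutRepH L) {π2 πn : IrrClass (Gqs L v)}
    (hK : KeysCaseTwoLabels L v (μ.semilocalComponent L v) (torusLocalComponent L (IsCMField.complexConj L) v ξ.η)
      (torusLocalComponent L (IsCMField.complexConj L) v ξ.ψ) π2 πn)
    (aX : IrrClass (Gqs L v) → ℤ) {πp πm : IrrClass (Gqs L v)} (hsupp : Function.support aX = {πp, πm})
    (hm : aX πm = -1) (h2 : aX π2 = 1)
    (hsucc : ∀ rp rm : SmoothIrrep (Gqs L v), IrrClass.mk rp = πp → IrrClass.mk rm = πm →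
      finrank ℂ ((cmBorelTriple L 3 v).restrict rp.ρ).Coinvariants = finrank ℂ ((cmBorelTriple L 3 v).restrict rm.ρ).Coinvariants + 1) :
    ∀ π : IrrClass (Gqs L v), aX π ≠ 0 → π ≠ π2 → π.IsSupercuspidal := by
  haveI := locallyCompactSpace_cmBorelU L 3 v
  have hbk := member_eq_of_support_pair aX hsupp hm h2
  rcases hbk with ⟨h2p, hmem⟩
  intro π hπ hπ2
  have hπm := hmem π hπ hπ2
  -- «KEYS-JQ»: `π2` has a representative with a one-dimensional Jacquet module
  have H := F0P3cStCharTSJacquetLine.labelledPair_xi L v hns μ hμω ξ hK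
  rcases H with ⟨πs', πn', -, hJH, hs, hn⟩
  have h2mem : π2 = πn' ∨ π2 = πs' := (hJH π2).1 (Or.inr rfl)
  have hr0 : ∃ r₀ : SmoothIrrep (Gqs L v), IrrClass.mk r₀ = π2 ∧ finrank ℂ ((cmBorelTriple L 3 v).restrict r₀.ρ).Coinvariants = 1 := by
    rcases h2mem with h | h
    · rcases hn with ⟨r, hr, ⟨e⟩⟩
      exact ⟨r, hr.trans h.symm, F0P3cStCharTSJacquetLine.finrank_coinvariants_eq_one_of_equiv_twist (cmBorelTriple L 3 v) e⟩
    · rcases hs with ⟨r, hr, ⟨e⟩⟩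
      exact ⟨r, hr.trans h.symm, F0P3cStCharTSJacquetLine.finrank_coinvariants_eq_one_of_equiv_twist (cmBorelTriple L 3 v) e⟩
  rcases hr0 with ⟨r₀, hr₀, hf1⟩
  -- a representative of `πm`; the dimension step forces `r_B(rm) = 0`
  have hrm' := IrrClass.mk_surjective πm
  rcases hrm' with ⟨rm, hrm⟩
  have key := hsucc r₀ rm (hr₀.trans h2p) hrm
  rw [hf1] at key
  have h0 : finrank ℂ ((cmBorelTriple L 3 v).restrict rm.ρ).Coinvariants = 0 := by omega
  haveI := (F0P3cStCharTSJacquetLine.finrank_coinvariants_le_two L v hns rm).1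
  have hsub : Subsingleton ((cmBorelTriple L 3 v).restrict rm.ρ).Coinvariants := Module.finrank_zero_iff.1 h0
  have hsc := u3_isSupercuspidal_iff_jacquet_eq_zero_mpr L v hns rm hsub
  rw [hrm] at hsc
  rw [hπm]
  exact hsc


end Core

end Summit.HodgeConjecture.HodgeConjecture.Cruxes.H413.F0P3cStCharTSCuspidalCore

end
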